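import Mathlib
import HarnessLib
import Summits.SmoothPoincare4.SmoothPoincare4.Theses.AlgebraicDegree

/-!
# Birth skeleton (BC3) for the crux `AlgebraicDegree.QuarticModels`
(item stmt-SmoothPoincare4-3400; route route-SmoothPoincare4-AlgebraicDegree, crux rank 3) —
skeleton registrar planner-skel-stmt-SmoothPoincare4-3400-0, 2026-08-17. Published as
`Cruxes/QuarticModels/Lines/birth.lean`.

The crux (`Summit.SmoothPoincare4.SmoothPoincare4.Theses.AlgebraicDegree.QuarticModels`): every
homotopy 4-sphere `S` admits a smooth embedding `e : S ↪ ℝ⁵` whose image is the NONSINGULAR zero set of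
a real polynomial `f ∈ ℝ[x₀,…,x₄]` of total degree `≤ 4` ("deg Σ ≤ 4 for every homotopy 4-sphere Σ").

## The line: MIRROR-SYMMETRIC QUARTIC MODELS VIA DOUBLES OF DOMAINS OF `ℝ⁴`

The route header (CHEAPEST FALSIFIER (ii); TWO-LAYER PLAN "reflection-symmetric models … doubles")
already names the one soft mechanism that could produce LOW-degree models: symmetry. A quartic that is
EVEN in the last variable and monic-quadratic in it has the shape `f(x, t) = t² − p(x)` with
`p ∈ ℝ[x₀,…,x₃]`, `deg p ≤ 4`; its zero set `{t² = p(x)}` is the UNTWISTED DOUBLE `D(K)` of the compact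
domain `K = {p ≥ 0} ⊂ ℝ⁴`, and it is nonsingular iff `p` is regular along `{p = 0} = ∂K`. So the
crux is implied by the conjunction of a purely differential-topological statement and a real-algebraic
statement ONE DIMENSION DOWN, and the seam between them is typed — two registered stubs:

* `stub_domainDouble` (topological half; open, size XL). Every homotopy 4-sphere `S` is the double of
  a regular compact domain of `ℝ⁴`: there are a smooth `g : ℝ⁴ → ℝ` with `{g ≥ 0}` compact and `0` a
  regular value along `{g = 0}`, and a smooth embedding `e : S ↪ ℝ⁵` with image the mirror-symmetric
  bi-graph hypersurface `{y : y₄² = g(y₀,…,y₃)} = D({g ≥ 0})`. Equivalently: `S ≅ D(K)` for a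
  compact contractible codimension-0 submanifold `K ⊂ ℝ⁴` with smooth boundary (a retract of
  `D(K) ≃ S⁴` with `H₄ = 0` is acyclic and simply connected; `∂K` is a homology 3-sphere). Consequence
  of SPC4 (`K = D⁴`, `g = 1 − |x|²`); NOT known: it forces `S ≅ −S` (the mirror `t ↦ −t` is an
  orientation-reversing involution of `S` fixing `∂K`), and the doubles `D(K) = ∂(K × I)` of
  contractible 2-handlebodies `K` are exactly the presentation homotopy spheres `∂N⁵(P)` (boundaries of
  the contractible 5-dimensional thickenings of balanced presentations `P` of the trivial group; any
  4-dimensional realisation `K` of `P` will do, stub 1 asks in addition `K ⊂ ℝ⁴`) — the classical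
  candidates: `D(K) ≅ S⁴` for Mazur's `K` (Mazur1961) and whenever `P` is Andrews–Curtis trivial
  (`K × I ≅ D⁵` by handle moves); the Akbulut–Kirby presentation sphere `⟨x,y ∣ xyx = yxy, x⁵ = y⁴⟩`
  (AkbulutKirby1985) was killed by Gompf (Topology 30 (1991) 97–115) by other means; open in general.
  Why it might fail: an exotic `Σ` with `Σ ≇ −Σ`, or one that bounds no contractible `K × I` inside
  `ℝ⁵`, violates it; nothing short of an exotic sphere refutes it.
* `stub_quarticDomain` (real-algebraic half, in `ℝ⁴`; open, size XL). Every homotopy 4-sphere that IS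
  such a double `D({g ≥ 0})`, `{g ≥ 0} ⊂ ℝ⁴`, is also a double over a QUARTIC domain: there are
  `p ∈ ℝ[x₀,…,x₃]` with `deg p ≤ 4`, regular along its real zero set, and a smooth embedding
  `e' : S ↪ ℝ⁵` with image `{y : y₄² = p(y₀,…,y₃)}`. This is "Hilbert XVI for contractible quartic
  domains of `ℝ⁴`": `K' = {p ≥ 0}` must be a compact contractible domain bounded by the nonsingular
  quartic 3-fold `{p = 0}` with `D(K') ≅ S`. Consequence of SPC4 (`p = 1 − |x|²`). Why it might fail:
  the degree of algebraic models is controlled only extrinsically (reach/condition number of a GIVEN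
  domain, LerarioStecconi2021 Thm 7, via the tree's Seifert machinery
  `Literature.Topology.FourManifolds.Seifert1936_algebraicModel_holds`, which gives SOME degree); if
  every compact contractible quartic domain of `ℝ⁴` is a 4-ball (cheapest falsifier-in-kind: is there a
  nonsingular compact real quartic 3-fold in `ℝ⁴` which is a homology 3-sphere with `π₁ ≠ 1` bounding a
  contractible region? Smith–Thom / Milnor–Thom Betti bounds do not forbid it, a homology sphere having
  total Betti number 2) then the stub says "domain doubles over `ℝ⁴` are standard" — still meaningful,
  but then the line is stub 1 + standardness of (these) presentation spheres.
* `QuarticModels_of : Sig.stub_domainDouble → Sig.stub_quarticDomain → QuarticModels` — the REAL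
  composition (sorry-free, standard axioms): with `(g, e)` from stub 1 and `(p, e')` from stub 2, the
  witness is `f := X₄² − rename castSucc p ∈ ℝ[x₀,…,x₄]`; `totalDegree f ≤ max 2 (deg p) ≤ 4`
  (`totalDegree_sub`, `totalDegree_X_pow`, `totalDegree_rename_le`); `f(y) = y₄² − p(y₀..y₃)`
  (`eval_rename`), so `Z(f) = {y₄² = p} = range e'`; NONSINGULARITY along `Z(f)`: `∂₄ f = 2X₄`
  (`pderiv` kills the renamed `p`), non-zero where `y₄ ≠ 0`, and where `y₄ = 0` we are on `{p = 0}`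
  and `∂_{castSucc j} f = −rename castSucc (∂ⱼ p)` (`MvPolynomial.pderiv_rename`) is non-zero for the
  `j` given by the regularity of `p`. About 60 lines; the only theorem whose head is the crux name
  besides the final `QuarticModels_proof`.

The conjunction of the stubs is the named STRENGTHENING `SymmetricQuarticModels` of the crux (every
`Σ` has a mirror-symmetric bi-graph quartic model); NEITHER stub is a weakening of the crux (a quartic
model need not be symmetric, so `QuarticModels → stub` is not available either — converse probes
recorded), neither is the crux or the summit reworded (BC3 probes below), and both are consequences of
`SmoothPoincare4` (irrefutable short of an exotic 4-sphere — the risk the route item already states).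
Why the strengthening is EASIER to attack, not a costume: stub 1 carries no algebra and lands in the
best-studied corner of SPC4 (doubles / presentation spheres / `K × I ≅ D⁵`, where Property-R-type and
Andrews–Curtis-type tools apply), stub 2 carries no exotic topology beyond its hypothesis and is a
statement about compact QUARTIC DOMAINS IN `ℝ⁴` and their bounding quartic 3-folds (one dimension and
one "sheet" below quartic 4-folds in `ℝ⁵`; rigid-isotopy / Smith-theoretic tools for real quartic
surfaces and 3-folds exist, none for 4-folds — route NUMBERS section).

## Disproof used / dead lines / negatives

`Cruxes/QuarticModels/` had no workfiles before this one (no `Disproof.lean`, no dead lines);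
`ledger negatives --problem SmoothPoincare4`: 0 refuted statements (2026-08-17). The neighbouring crux
`ConvexBisection.ContractibleTwistedDoubleStandard` (Stein TWISTED doubles ⇒ standard) is a standardness
statement for twisted doubles inside a given `M`; stub 1 here is an EXISTENCE statement for untwisted
domain doubles and stub 2 is algebraic — no overlap of levers.

## BC3 audit (this seat; raw outputs in the seat's NOTES.md `birth-certificate:`)

`lean check --json` rc 0 with `sorry` exactly in `stub_domainDouble`, `stub_quarticDomain` (sorry
count 2 = stub count, zero elsewhere); probes `stub → QuarticModels` and `stub → SmoothPoincare4` by
`first | exact? | simpa [stub] | (unfold stub; simpa) | aesop` FAIL for both stubs (4/4), and the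
converse probes `QuarticModels → stub` FAIL too (2/2); file `bc/QuarticModels_stub_probes.lean` of the
seat folder. Special case (BC5, definitions compute): `zeroSet_dbl_ball` — the double of the unit-ball
domain `p = 1 − Σ xᵢ²` is the round unit sphere of `ℝ⁵` (sorry-free).
-/

set_option linter.dupNamespace false
set_option linter.unusedVariables false

noncomputable section

namespace Summit.SmoothPoincare4.SmoothPoincare4.Cruxes.QuarticModels.Birth

open scoped Manifold ContDiff BigOperators
open Set Function MvPolynomial
open Literature.Topology.FourManifolds
open Summit.SmoothPoincare4.SmoothPoincare4.Theses.AlgebraicDegree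

/-! ### Vocabulary of the seam (plain `def`s over Mathlib declarations) -/

/-- `IsRegularCompactDomainFn g`: `g : ℝ⁴ → ℝ` is smooth, the closed domain `K = {g ≥ 0}` is
compact, and `0` is a regular value of `g` along `∂K = {g = 0}` (non-zero derivative), so that `K` is a
compact codimension-0 submanifold of `ℝ⁴` with smooth boundary and `{(x,t) : t² = g(x)}` is a smooth
closed hypersurface of `ℝ⁵`, the double `D(K)`. -/
def IsRegularCompactDomainFn (g : (Fin 4 → ℝ) → ℝ) : Prop :=
  ContDiff ℝ ∞ g ∧ IsCompact {x | 0 ≤ g x} ∧ ∀ x, g x = 0 → fderiv ℝ g x ≠ 0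

/-- `doubleOver g ⊆ ℝ⁵`: the mirror-symmetric bi-graph hypersurface `{y : y₄² = g(y₀,…,y₃)}` — the
untwisted double of the domain `{g ≥ 0} ⊂ ℝ⁴` (upper sheet `y₄ = +√g`, lower sheet `y₄ = −√g`, glued
along `{g = 0} × {0}`). -/
def doubleOver (g : (Fin 4 → ℝ) → ℝ) : Set (EuclideanSpace ℝ (Fin 5)) :=
  {y | (WithLp.ofLp y (Fin.last 4)) ^ 2 = g (fun i => WithLp.ofLp y (Fin.castSucc i))}

/-- Membership in `doubleOver g`. [folklore] -/
@[simp] theorem mem_doubleOver {g : (Fin 4 → ℝ) → ℝ} {y : EuclideanSpace ℝ (Fin 5)} :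
    y ∈ doubleOver g ↔
      (WithLp.ofLp y (Fin.last 4)) ^ 2 = g (fun i => WithLp.ofLp y (Fin.castSucc i)) :=
  Iff.rfl

/-! ### Stub signatures (`Sig.stub_*`, so that the hypothesis heads of `QuarticModels_of` carry the
registered stub names) -/

/-- STUB 1 — EVERY HOMOTOPY 4-SPHERE IS THE DOUBLE OF A REGULAR COMPACT DOMAIN OF `ℝ⁴` (topological
half; open, size XL). For every `S : HomotopySphere 4` there are `g : ℝ⁴ → ℝ` smooth with `{g ≥ 0}`
compact and `0` regular along `{g = 0}`, and a smooth embedding `e : S ↪ ℝ⁵` with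
`range e = {y : y₄² = g(y₀,…,y₃)}`; i.e. `S ≅ D(K)`, `K = {g ≥ 0} ⊂ ℝ⁴` compact contractible with
homology-sphere boundary. Consequence of SPC4 (`g = 1 − |x|²`); forces `S ≅ −S`; contains the
presentation spheres `∂N⁵(P) = D(K)`, `K ⊂ ℝ⁴` a contractible 2-handlebody realising `P` (Mazur1961,
AkbulutKirby1985, Gompf, Topology 30 (1991) 97–115). Why it might fail: an exotic chiral `Σ`, or one
bounding no `K × I ⊂ ℝ⁵`. Sources: KervaireMilnorAnnals1963 (Θ₄ʰ = 0, `Σ ↪ ℝ⁵`), Mazur1961,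
AkbulutKirby1985, Kirby1997 (Problem 4.89 SPC4, Problem 5.2 Andrews–Curtis). -/
def Sig.stub_domainDouble : Prop :=
  ∀ S : HomotopySphere 4,
    ∃ (g : (Fin 4 → ℝ) → ℝ) (e : S.carrier → EuclideanSpace ℝ (Fin 5)),
      IsRegularCompactDomainFn g ∧
      Manifold.IsSmoothEmbedding (𝓡 4) (𝓡 5) ∞ e ∧ range e = doubleOver g

/-- STUB 2 — DOMAIN DOUBLES CARRYING A HOMOTOPY-SPHERE STRUCTURE ARE DOUBLES OVER QUARTIC DOMAINS
(real-algebraic half, one dimension down; open, size XL). For every `S : HomotopySphere 4`, every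
regular compact domain function `g` on `ℝ⁴` and every smooth embedding `e : S ↪ ℝ⁵` onto
`{y₄² = g}`, there are `p ∈ ℝ[x₀,…,x₃]` of total degree `≤ 4`, regular along its real zero set
(`p(x) = 0 ⇒ ∂ⱼp(x) ≠ 0` for some `j`), and a smooth embedding `e' : S ↪ ℝ⁵` with
`range e' = {y : y₄² = p(y₀,…,y₃)}` (so `K' = {p ≥ 0}` is a compact contractible QUARTIC domain of `ℝ⁴`
with `D(K') ≅ S`). Consequence of SPC4 (`p = 1 − Σ xᵢ²`). Why it might fail: degree of models is
controlled only by the extrinsic geometry of a given domain (LerarioStecconi2021 Thm 7; Seifert gives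
SOME degree: `Seifert1936_algebraicModel_holds`); compact contractible quartic domains of `ℝ⁴` may all
be balls. Sources: LerarioStecconi2021 (arXiv:2010.14553), Seifert1936, AkbulutKing1992 Thm 2.8.2,
BochnakCosteRoy1998 ch. 12–14. -/
def Sig.stub_quarticDomain : Prop :=
  ∀ (S : HomotopySphere 4) (g : (Fin 4 → ℝ) → ℝ) (e : S.carrier → EuclideanSpace ℝ (Fin 5)),
    IsRegularCompactDomainFn g →
    Manifold.IsSmoothEmbedding (𝓡 4) (𝓡 5) ∞ e → range e = doubleOver g →
      ∃ (p : MvPolynomial (Fin 4) ℝ) (e' : S.carrier → EuclideanSpace ℝ (Fin 5)),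
        p.totalDegree ≤ 4 ∧
        (∀ x : Fin 4 → ℝ, MvPolynomial.eval x p = 0 →
          ∃ j : Fin 4, MvPolynomial.eval x (MvPolynomial.pderiv j p) ≠ 0) ∧
        Manifold.IsSmoothEmbedding (𝓡 4) (𝓡 5) ∞ e' ∧
        range e' = doubleOver (fun x => MvPolynomial.eval x p)

/-! ### Registered stubs -/

/-- Registered stub 1 (topological half — domain doubles; load-bearing for chirality/existence). -/
theorem stub_domainDouble : Sig.stub_domainDouble := by
  sorry

/-- Registered stub 2 (real-algebraic half in `ℝ⁴` — quartic domains; load-bearing for the degree). -/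
theorem stub_quarticDomain : Sig.stub_quarticDomain := by
  sorry

/-! ### Sorry-free infrastructure: the model quartic `x₄² − p(x₀,…,x₃)` -/

/-- The model polynomial `dbl p := X₄² − p(X₀,…,X₃) ∈ ℝ[x₀,…,x₄]` whose zero set is the double
`{y₄² = p(y₀,…,y₃)}` of the domain `{p ≥ 0} ⊂ ℝ⁴`. -/
def dbl (p : MvPolynomial (Fin 4) ℝ) : MvPolynomial (Fin 5) ℝ :=
  X (Fin.last 4) ^ 2 - rename Fin.castSucc p

/-- A renamed polynomial is killed by the partial derivatives in the variables outside the range of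
the renaming. [folklore] -/
theorem pderiv_rename_eq_zero_of_forall_ne {σ τ R : Type*} [CommSemiring R] {f : σ → τ}
    {z : τ} (hz : ∀ s, f s ≠ z) (Q : MvPolynomial σ R) : pderiv z (rename f Q) = 0 := by
  induction Q using MvPolynomial.induction_on with
  | C a => simp
  | add p q hp hq => simp [hp, hq]
  | mul_X p s hp => simp [hp, pderiv_X_of_ne (hz s)]

/-- `deg (x₄² − p) ≤ 4` when `deg p ≤ 4`. [folklore] -/
theorem totalDegree_dbl (p : MvPolynomial (Fin 4) ℝ) (hp : p.totalDegree ≤ 4) :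
    (dbl p).totalDegree ≤ 4 := by
  unfold dbl
  refine (totalDegree_sub _ _).trans (max_le ?_ ((totalDegree_rename_le _ _).trans hp))
  rw [totalDegree_X_pow]
  norm_num

/-- `(x₄² − p)(v) = v₄² − p(v₀,…,v₃)`. [folklore] -/
theorem eval_dbl (p : MvPolynomial (Fin 4) ℝ) (v : Fin 5 → ℝ) :
    eval v (dbl p) = v (Fin.last 4) ^ 2 - eval (fun i => v (Fin.castSucc i)) p := by
  simp [dbl, eval_rename, Function.comp_def]

/-- `∂₄ (x₄² − p) = 2x₄`. [folklore] -/
theorem pderiv_last_dbl (p : MvPolynomial (Fin 4) ℝ) :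
    pderiv (Fin.last 4) (dbl p) = 2 * X (Fin.last 4) := by
  unfold dbl
  rw [map_sub, pderiv_rename_eq_zero_of_forall_ne (fun s => (Fin.castSucc_lt_last s).ne) p,
    sub_zero, pderiv_pow, pderiv_X_self]
  ring

/-- `∂ⱼ (x₄² − p) = −∂ⱼ p` for `j < 4` (`MvPolynomial.pderiv_rename`). [folklore] -/
theorem pderiv_castSucc_dbl (p : MvPolynomial (Fin 4) ℝ) (j : Fin 4) :
    pderiv (Fin.castSucc j) (dbl p) = -rename Fin.castSucc (pderiv j p) := by
  unfold dbl
  rw [map_sub, pderiv_rename (Fin.castSucc_injective 4), pderiv_pow,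
    pderiv_X_of_ne (Fin.castSucc_lt_last j).ne', mul_zero, zero_sub]

/-- **Nonsingularity of the double.** If `p` is regular along its real zero set then `x₄² − p` is
nonsingular along its real zero set: off the mirror `∂₄ = 2x₄ ≠ 0`, on the mirror `p = 0` and some
`∂ⱼ p ≠ 0`. [folklore] -/
theorem nonsing_dbl (p : MvPolynomial (Fin 4) ℝ)
    (hp : ∀ x : Fin 4 → ℝ, eval x p = 0 → ∃ j : Fin 4, eval x (pderiv j p) ≠ 0)
    (v : Fin 5 → ℝ) (hv : eval v (dbl p) = 0) :
    ∃ i : Fin 5, eval v (pderiv i (dbl p)) ≠ 0 := by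
  by_cases h : v (Fin.last 4) = 0
  · have h0 : eval (fun i => v (Fin.castSucc i)) p = 0 := by
      rw [eval_dbl, h] at hv
      simpa using hv
    obtain ⟨j, hj⟩ := hp _ h0
    refine ⟨Fin.castSucc j, ?_⟩
    rw [pderiv_castSucc_dbl, map_neg, eval_rename]
    simpa [Function.comp_def] using hj
  · refine ⟨Fin.last 4, ?_⟩
    rw [pderiv_last_dbl]
    simpa using h

/-- The real zero set of `x₄² − p` is the double over the domain function `x ↦ p(x)`. [folklore] -/
theorem zeroSet_dbl (p : MvPolynomial (Fin 4) ℝ) :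
    {y : EuclideanSpace ℝ (Fin 5) | eval (WithLp.ofLp y) (dbl p) = 0} =
      doubleOver (fun x => eval x p) := by
  ext y
  simp [doubleOver, eval_dbl, sub_eq_zero]

/-- **Special case / sanity (BC5-type: the definitions compute).** The double of the unit-ball domain
`p = 1 − Σᵢ xᵢ²` of `ℝ⁴` is the round unit sphere of `ℝ⁵` — the degree-2 model of `S⁴` in the
line's normal form. [folklore] -/
theorem zeroSet_dbl_ball :
    {y : EuclideanSpace ℝ (Fin 5) |
        eval (WithLp.ofLp y) (dbl (1 - ∑ i : Fin 4, X i ^ 2)) = 0} =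
      Metric.sphere (0 : EuclideanSpace ℝ (Fin 5)) 1 := by
  ext y
  rw [Set.mem_setOf_eq, eval_dbl, mem_sphere_zero_iff_norm, EuclideanSpace.norm_eq,
    Real.sqrt_eq_one, Fin.sum_univ_castSucc (n := 4)]
  simp only [map_sub, map_one, map_sum, map_pow, eval_X, Real.norm_eq_abs, sq_abs]
  constructor <;> intro h <;> linarith

/-! ### Composition -/

/-- **The line closes the crux BY NAME modulo the two registered stubs.** From stub 1 take the domain
function `g` and the embedding `e : S ↪ {y₄² = g}`; stub 2 replaces them by a quartic domain
`p ∈ ℝ[x₀..x₃]` (`deg ≤ 4`, regular along `{p = 0}`) and `e' : S ↪ {y₄² = p}`; the witness for the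
crux is `f := x₄² − p` with `e'`: degree `≤ 4` (`totalDegree_dbl`), nonsingular along `Z(f)`
(`nonsing_dbl`), `Z(f) = {y₄² = p} = range e'` (`zeroSet_dbl`). [folklore] -/
theorem QuarticModels_of :
    Sig.stub_domainDouble → Sig.stub_quarticDomain →
      Summit.SmoothPoincare4.SmoothPoincare4.Theses.AlgebraicDegree.QuarticModels := by
  intro hA hB S
  obtain ⟨g, e, hg, he, hrange⟩ := hA S
  obtain ⟨p, e', hdeg, hreg, he', hrange'⟩ := hB S g e hg he hrange
  refine ⟨dbl p, e', totalDegree_dbl p hdeg, ?_, he', ?_⟩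
  · intro x hx
    exact nonsing_dbl p hreg (WithLp.ofLp x) hx
  · rw [hrange', zeroSet_dbl]

/-- The skeleton in its final shape (D-0027 §3.3): the crux BY NAME from the two registered stubs; it
becomes the crux proof when the last `stub_*` is discharged (until then it depends on `sorryAx` through
the stubs only — no `sorry` of its own). [folklore] -/
theorem QuarticModels_proof :
    Summit.SmoothPoincare4.SmoothPoincare4.Theses.AlgebraicDegree.QuarticModels :=
  QuarticModels_of stub_domainDouble stub_quarticDomain

end Summit.SmoothPoincare4.SmoothPoincare4.Cruxes.QuarticModels.Birth

end
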